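import Mathlib.FieldTheory.Galois.Basic
import Summits.BirchSwinnertonDyer.BirchSwinnertonDyer.Theorems.GenusKolyvaginAtTwoTorsionCellGenusDepthTwistDescent
import Summits.BirchSwinnertonDyer.BirchSwinnertonDyer.Theorems.GenusKolyvaginAtTwoTorsionCellGenusDepthPoints
import HarnessLib

/-!
# LINE 49 «full_vertex» — EIGENVECTORS ARE TWIST POINTS over a GALOIS layer of any degree (the `k ≥ 2` multiquadratic descent)

Crux R″ `RankOneTwoTorsionResidualAtTwo` (stmt-BirchSwinnertonDyer-27478) of route GenusKolyvaginAtTwo, LINE 49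
«torsion_cell_full_vertex_bsdidea1» (pen bsd-idea-1); sequel of `…GenusDepthTwistDescent` (the quadratic layer `k = 1`)
and `…GenusDepthPoints` (the (LOW) dictionary / exponent bound on `E(L)`, whose hypothesis `hsat` — «every `χ`-eigenvector
of `E(L)` is an integer multiple of `g χ` up to torsion» — was left undischarged for `k ≥ 2`).  Here `L/F` is ANY finite
GALOIS extension (the genus field `K_gen = K(√q₁*, …, √q_k*)` over `K`), `θ ∈ L ∖ F` with `θ² = c ∈ F` (`2 ≠ 0`), and
`χ : Aut(L/F) → ℤˣ` any sign function with `σ θ = χ σ • θ` (the sign character `χ_θ` of `…GenusDepthTwistEigen`; for the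
multiquadratic genus field every non-trivial character of `Gal(K_gen/K) ≅ (ℤ/2)^k` is such a `χ_θ`, `θ = √d` a sub-product):

* `exists_eq_algebraMap_of_forall_apply_eq` — Galois descent for elements (Mathlib `IsGalois.mem_range_algebraMap_iff_fixed`);
* **`exists_incl_eq_of_forall_smul_eq`** — a point of `V(L)` fixed by `Aut(L/F)` is `F`-rational (the trivial character);
* **`exists_twistMap_eq_of_forall_smul_eq_signChar_smul`** — a `χ_θ`-EIGENVECTOR `P ∈ W^{(1)}(L)` (`σ • P = χ_θ(σ) • P` for
  all `σ`) is a TWIST POINT: `P = τ R`, `R ∈ W^{(c)}(F)`, `τ = QuadraticDescent.twistMap W hθ hc : W^{(c)}(F) →+ W^{(1)}(L)`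
  (mechanism: `x(P)` and `y(P)/θ` are `Aut(L/F)`-fixed, hence in `F`; no intermediate field is needed).  With
  `…GenusDepthTwistEigen.smul_twistMap_eq_signChar_smul` (tree): the `χ_θ`-eigenvectors are EXACTLY `τ(W^{(c)}(F))`;
* **`exists_sub_zsmul_twistMap_mem_torsion_of_generator_gal`**, `exists_sub_zsmul_incl_mem_torsion_of_generator_gal` — the
  dictionary's `hsat` for `χ_θ` (rank-one twist `W^{(c)}(F) = ℤ R₀ + tors`) and for the trivial character;
* **`two_pow_card_smul_mem_span_sup_torsion_of_twist_generators`** — memo #6 §2.3 EXPONENT BOUND made unconditional in its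
  algebraic inputs: if `Aut(L/F)` is elementary abelian of order `2^k`, every non-trivial character is the sign character
  of a square root `θ_χ` of some `c_χ ∈ F`, and the eigen-generators are `g 1 = ι(Q₀)`, `g χ = τ_χ(R_χ)` with `W^{(1)}(F) =
  ℤ Q₀ + tors`, `W^{(c_χ)}(F) = ℤ R_χ + tors`, then `2^k • x ∈ (Σ_χ ℤ g χ) + W^{(1)}(L)_tors` for EVERY `x ∈ W^{(1)}(L)`
  («`exp(E₀(K_gen)/(M′ + tors)) ∣ 2^k`»).

Pure algebra of the models (Silverman AEC X.2 / Ex. 10.16 over a Galois layer); no Heegner point, no `L`-function; nothing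
here is a statement of the line, and NOTHING HERE PROVES R″ or any summit — BSD is not advanced by this file alone.

## References

* [SilvermanAEC2009] J. H. Silverman, *The Arithmetic of Elliptic Curves*, 2nd ed. (2009), X.2 (proof of Prop. 2.4), X.5
  Cor. 5.4, Exercise 10.16; VIII.§1 (Galois action on points).
* [TianYuanZhang2017] Y. Tian, X. Yuan, S.-W. Zhang, *Genus periods, genus points and congruent number problem*, Asian J.
  Math. 21 (2017), §1 (genus points as eigencomponents over the genus field).
-/

noncomputable section

open scoped Classical

namespace Summit.BirchSwinnertonDyer.BirchSwinnertonDyer.Theorems.GenusKolyvaginAtTwo.FullVertex.GenusDepth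

open WeierstrassCurve WeierstrassCurve.QuadraticDescent
open Literature.NumberTheory.QuadraticFields.Quadratic (ne_zero_of_not_mem_range)

universe u

variable {F L : Type u} [Field F] [Field L] [Algebra F L] [FiniteDimensional F L] [IsGalois F L]

/-- Galois descent for elements of a finite Galois extension: fixed by every automorphism ⟹ in the base field
(Mathlib `IsGalois.mem_range_algebraMap_iff_fixed`). [cite: SilvermanAEC2009, VIII.§1] -/
theorem exists_eq_algebraMap_of_forall_apply_eq {x : L} (hx : ∀ σ : L ≃ₐ[F] L, σ x = x) :
    ∃ a : F, algebraMap F L a = x :=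
  (IsGalois.mem_range_algebraMap_iff_fixed x).2 hx

/-- **Fixed points are rational (Galois layer).**  A point of `V(L)` fixed by every `σ ∈ Aut(L/F)` (`L/F` finite Galois)
comes from `V(F)`: `P = ι Q`.  (The trivial-character case of the eigen-decomposition; `…GenusDepthTwistDescent` has the
quadratic layer.) [cite: SilvermanAEC2009, VIII.§1] -/
theorem exists_incl_eq_of_forall_smul_eq (V : WeierstrassCurve F) (P : (V.baseChange L).toAffine.Point)
    (hP : ∀ σ : L ≃ₐ[F] L, σ • P = P) : ∃ Q : V.toAffine.Point, incl L V Q = P := by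
  rcases P with _ | ⟨x, y, h⟩
  · exact ⟨0, (map_zero _).trans Affine.Point.zero_def⟩
  · have hxy : ∀ σ : L ≃ₐ[F] L, (σ : L →ₐ[F] L) x = x ∧ (σ : L →ₐ[F] L) y = y := by
      intro σ
      have hσ := hP σ
      rw [WeierstrassCurve.smul_def, Affine.Point.map_some, Affine.Point.some.injEq] at hσ
      exact hσ
    obtain ⟨a, ha⟩ := exists_eq_algebraMap_of_forall_apply_eq (F := F) (fun σ => (hxy σ).1)
    obtain ⟨b, hb⟩ := exists_eq_algebraMap_of_forall_apply_eq (F := F) (fun σ => (hxy σ).2)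
    exact exists_incl_eq V h ha hb

/-- The dictionary's `hsat` for the TRIVIAL character over a Galois layer: if `V(F) = ℤ Q₀ + tors`, every `Aut(L/F)`-fixed
point `P ∈ V(L)` satisfies `P − a • ι Q₀ ∈ V(L)_tors` for some `a ∈ ℤ`. [cite: SilvermanAEC2009, VIII.§1] -/
theorem exists_sub_zsmul_incl_mem_torsion_of_generator_gal (V : WeierstrassCurve F) (Q₀ : V.toAffine.Point)
    (hgen : ∀ Q : V.toAffine.Point, ∃ a : ℤ, Q - a • Q₀ ∈ AddCommGroup.torsion V.toAffine.Point)
    (P : (V.baseChange L).toAffine.Point) (hP : ∀ σ : L ≃ₐ[F] L, σ • P = P) :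
    ∃ a : ℤ, P - a • incl L V Q₀ ∈ AddCommGroup.torsion (V.baseChange L).toAffine.Point := by
  obtain ⟨Q, rfl⟩ := exists_incl_eq_of_forall_smul_eq V P hP
  obtain ⟨a, ha⟩ := hgen Q
  refine ⟨a, ?_⟩
  rw [← map_zsmul, ← map_sub]
  rw [AddCommGroup.mem_torsion, isOfFinAddOrder_iff_nsmul_eq_zero] at ha ⊢
  obtain ⟨n, hn, hnQ⟩ := ha
  exact ⟨n, hn, by rw [← map_nsmul, hnQ, map_zero]⟩

variable [NeZero (2 : F)] (W : WeierstrassCurve F) {θ : L} {c : F}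
  (hθ : θ ∉ Set.range (algebraMap F L)) (hc : θ ^ 2 = algebraMap F L c)

/-- **Eigenvectors are twist points (Galois layer of any degree).**  `L/F` finite Galois, `θ ∈ L ∖ F`, `θ² = c ∈ F`,
`2 ≠ 0`, and `χ : Aut(L/F) → ℤˣ` with `σ θ = χ σ • θ` (the sign character of `θ`).  A point `P ∈ W^{(1)}(L)` with
`σ • P = χ σ • P` for EVERY `σ` is in the image of the twisting map: `P = τ R`, `R ∈ W^{(c)}(F)`.  Mechanism: `x(P)` is fixed
by all `σ`, and so is `y(P)/θ`; both lie in `F` by Galois descent, and `…exists_twistMap_eq` (tree) recognises `τ(ca, c²b)`.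
[cite: SilvermanAEC2009, Exercise 10.16] -/
theorem exists_twistMap_eq_of_forall_smul_eq_signChar_smul (χ : (L ≃ₐ[F] L) → ℤˣ)
    (hχ : ∀ σ : L ≃ₐ[F] L, σ θ = ((χ σ : ℤˣ) : ℤ) • θ)
    (P : ((W.quadraticTwist 1).baseChange L).toAffine.Point)
    (hP : ∀ σ : L ≃ₐ[F] L, σ • P = ((χ σ : ℤˣ) : ℤ) • P) :
    ∃ R : (W.quadraticTwist c).toAffine.Point, twistMap W hθ hc R = P := by
  rcases P with _ | ⟨x, y, h⟩
  · exact ⟨0, (map_zero _).trans Affine.Point.zero_def⟩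
  · have hθ0 : θ ≠ 0 := ne_zero_of_not_mem_range hθ
    -- coordinates: `σ x = x` and `σ y = χ σ • y`
    have hxy : ∀ σ : L ≃ₐ[F] L, (σ : L →ₐ[F] L) x = x ∧ (σ : L →ₐ[F] L) y = ((χ σ : ℤˣ) : ℤ) • y := by
      intro σ
      have hσ := hP σ
      rcases Int.units_eq_one_or (χ σ) with h1 | h1
      · rw [h1, Units.val_one, one_zsmul, WeierstrassCurve.smul_def, Affine.Point.map_some,
          Affine.Point.some.injEq] at hσ
        rw [h1, Units.val_one, one_zsmul]
        exact hσ
      · rw [h1, Units.val_neg, Units.val_one, neg_one_zsmul, WeierstrassCurve.smul_def, Affine.Point.map_some,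
          Affine.Point.neg_some, Affine.Point.some.injEq, negY_quadraticTwist_one_baseChange] at hσ
        rw [h1, Units.val_neg, Units.val_one, neg_one_zsmul]
        exact hσ
    obtain ⟨a, ha⟩ := exists_eq_algebraMap_of_forall_apply_eq (F := F) (fun σ => (hxy σ).1)
    -- `y / θ` is fixed by every `σ`
    have hfix : ∀ σ : L ≃ₐ[F] L, σ (y / θ) = y / θ := by
      intro σ
      have hy : σ y = ((χ σ : ℤˣ) : ℤ) • y := (hxy σ).2
      rw [map_div₀, hy, hχ σ]
      rcases Int.units_eq_one_or (χ σ) with h1 | h1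
      · rw [h1, Units.val_one, one_zsmul, one_zsmul]
      · rw [h1, Units.val_neg, Units.val_one, neg_one_zsmul, neg_one_zsmul, neg_div_neg_eq]
    obtain ⟨b, hb⟩ := exists_eq_algebraMap_of_forall_apply_eq (F := F) hfix
    refine exists_twistMap_eq W hθ hc h ha (b := b) ?_
    rw [hb, div_mul_cancel₀ y hθ0]

/-- **The dictionary's `hsat` over a Galois layer.**  If `W^{(c)}(F)` is generated by `R₀` up to torsion (rank one), then
every `χ_θ`-eigenvector `P ∈ W^{(1)}(L)` satisfies `P − a • τ R₀ ∈ W^{(1)}(L)_tors` for some `a ∈ ℤ` — the input `hsat` of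
`…GenusDepthPoints.two_pow_card_smul_mem_span_sup_torsion_point` for the character `χ_θ`, at any `k`.
[cite: SilvermanAEC2009, Exercise 10.16] -/
theorem exists_sub_zsmul_twistMap_mem_torsion_of_generator_gal (χ : (L ≃ₐ[F] L) → ℤˣ)
    (hχ : ∀ σ : L ≃ₐ[F] L, σ θ = ((χ σ : ℤˣ) : ℤ) • θ)
    (R₀ : (W.quadraticTwist c).toAffine.Point)
    (hgen : ∀ R : (W.quadraticTwist c).toAffine.Point,
      ∃ a : ℤ, R - a • R₀ ∈ AddCommGroup.torsion (W.quadraticTwist c).toAffine.Point)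
    (P : ((W.quadraticTwist 1).baseChange L).toAffine.Point)
    (hP : ∀ σ : L ≃ₐ[F] L, σ • P = ((χ σ : ℤˣ) : ℤ) • P) :
    ∃ a : ℤ, P - a • twistMap W hθ hc R₀ ∈ AddCommGroup.torsion ((W.quadraticTwist 1).baseChange L).toAffine.Point := by
  obtain ⟨R, rfl⟩ := exists_twistMap_eq_of_forall_smul_eq_signChar_smul W hθ hc χ hχ P hP
  obtain ⟨a, ha⟩ := hgen R
  refine ⟨a, ?_⟩
  rw [← map_zsmul, ← map_sub]
  rw [AddCommGroup.mem_torsion, isOfFinAddOrder_iff_nsmul_eq_zero] at ha ⊢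
  obtain ⟨n, hn, hnR⟩ := ha
  exact ⟨n, hn, by rw [← map_nsmul, hnR, map_zero]⟩

/-- **EXPONENT BOUND with rank-one twist data (memo #6 §2.3), any Galois layer with `Aut(L/F) ≅ (ℤ/2)^k`.**  Suppose every
non-trivial character `χ` of `Aut(L/F)` is the sign character of a square root `θ_χ ∈ L ∖ F` of some `c_χ ∈ F`, and the
eigen-generators are `g 1 = ι Q₀` with `W^{(1)}(F) = ℤ Q₀ + tors` and `g χ = τ_χ R_χ` with `W^{(c_χ)}(F) = ℤ R_χ + tors`
(`χ ≠ 1`).  Then `2^k • x ∈ (Σ_χ ℤ g χ) + W^{(1)}(L)_tors` for EVERY `x ∈ W^{(1)}(L)`: the index of `M′ + tors` in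
`E₀(K_gen)` divides `2^k`, unconditionally in the algebra (the arithmetic inputs are the ranks of the twists).
[cite: TianYuanZhang2017, §1] [cite: SilvermanAEC2009, Exercise 10.16] -/
theorem two_pow_card_smul_mem_span_sup_torsion_of_twist_generators [Fintype ((L ≃ₐ[F] L) →* ℤˣ)] {k : ℕ}
    (hG : Fintype.card (L ≃ₐ[F] L) = 2 ^ k) (h2 : ∀ σ : L ≃ₐ[F] L, σ * σ = 1)
    (g : ((L ≃ₐ[F] L) →* ℤˣ) → ((W.quadraticTwist 1).baseChange L).toAffine.Point)
    (h1 : ∃ Q₀ : (W.quadraticTwist 1).toAffine.Point, g 1 = incl L (W.quadraticTwist 1) Q₀ ∧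
      ∀ Q : (W.quadraticTwist 1).toAffine.Point,
        ∃ a : ℤ, Q - a • Q₀ ∈ AddCommGroup.torsion (W.quadraticTwist 1).toAffine.Point)
    (hχ : ∀ χ : (L ≃ₐ[F] L) →* ℤˣ, χ ≠ 1 →
      ∃ (θ : L) (c : F) (hθ : θ ∉ Set.range (algebraMap F L)) (hc : θ ^ 2 = algebraMap F L c),
        (∀ σ : L ≃ₐ[F] L, σ θ = ((χ σ : ℤˣ) : ℤ) • θ) ∧
        ∃ R₀ : (W.quadraticTwist c).toAffine.Point, g χ = twistMap W hθ hc R₀ ∧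
          ∀ R : (W.quadraticTwist c).toAffine.Point,
            ∃ a : ℤ, R - a • R₀ ∈ AddCommGroup.torsion (W.quadraticTwist c).toAffine.Point)
    (x : ((W.quadraticTwist 1).baseChange L).toAffine.Point) :
    ((2 : ℤ) ^ k) • x ∈ (Submodule.span ℤ (Set.range g)).toAddSubgroup ⊔
      AddCommGroup.torsion ((W.quadraticTwist 1).baseChange L).toAffine.Point := by
  refine two_pow_card_smul_mem_span_sup_torsion_point (W.quadraticTwist 1) hG h2 g ?_ x
  intro χ P hP
  by_cases hχ1 : χ = 1
  · subst hχ1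
    obtain ⟨Q₀, hg1, hgen⟩ := h1
    rw [hg1]
    refine exists_sub_zsmul_incl_mem_torsion_of_generator_gal (W.quadraticTwist 1) Q₀ hgen P fun σ => ?_
    have := hP σ
    rwa [MonoidHom.one_apply, Units.val_one, one_zsmul] at this
  · obtain ⟨θ, c, hθ, hc, hsign, R₀, hgχ, hgen⟩ := hχ χ hχ1
    rw [hgχ]
    exact exists_sub_zsmul_twistMap_mem_torsion_of_generator_gal W hθ hc (fun σ => χ σ) hsign R₀ hgen P hP

end Summit.BirchSwinnertonDyer.BirchSwinnertonDyer.Theorems.GenusKolyvaginAtTwo.FullVertex.GenusDepth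

end
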